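import Mathlib
import Literature.MathematicalPhysics.QuantumFieldTheory.Balaban1983to89.B5Ineq110Gp

/-!
# B5 p. 39: the transfer G′ ↝ G₀ by the identity (1.133) — the hypothesis `transfer` of S3

Paper **B5** = T. Bałaban, *Propagators and renormalization transformations for lattice gauge theories. I*,
Comm. Math. Phys. **95** (1984) 17–40 [cite: Balaban1984PropagatorsI].  Journal page = PDF page + 16.

## What the paper prints (verbatim, p. 39 [PDF 23], from the page render)

«G = G₀ + G₀∂P∂*G, (1.132) where G₀ = (Δ + aQ*Q)^{−1}. This operator is similar to G′, but with the different
averaging operator. We will prove (1.115)–(1.117), and in fact the whole Proposition 1.2, for the operator G₀.»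
«Properties of the operator G₀ can be easily reduced to the corresponding properties of the operator G′ by the
equality G₀ = G′ + G′(a_kQ′*Q′ − aQ*Q)G₀. (1.133) We only have to know some weak bounds for G₀, for example
bounds in the L²-norm (1.89), or (1.114).»  And, same page: «Thus its momentum representation is given by (1.87)
and we have Proposition 1.1 for G₀. This leads also to (1.114) by the same reasoning with a random walk expansion
as for G. In paper [2] we have proved all the necessary properties of G′, except the second order inequalities
(1.112), (1.113).»  Proposition 1.2 itself ((1.110)–(1.114), pp. 35–36) is typed verbatim in `B5.Prop12Printed`.

## What this module does (kernel-checked) and what it does NOT do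

In the S3 chain `B5FromB4.prop12G0_of_B4` → `B5Ineq137.prop12G0_of_B4_via137` →
`B5Ineq113.prop12G0_of_B4_via137_113` → `B5Ineq110Gp.prop12G0_of_B4_via135` the sentence around (1.133) is the
NAMED HYPOTHESIS
`transfer : FirstOrderFam famGp → SecondOrderFam famGp → B5.Local114Fam famG0 → FirstOrderFam famG0 ∧ SecondOrderFam famG0`
("easily reduced … We only have to know some weak bounds for G₀").  Nothing of that reduction is printed.  Here it
is DERIVED, for every instance of a family, from a located display and a located dictionary:

* `Display133` — the identity (1.133) applied ENTRYWISE, in weak form.  Writing V = a_kQ′*Q′ − aQ*Q and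
  decomposing VG₀J = Σ_{y″ ∈ T₁} 1_{Δ(y″)}VG₀J into unit-cube pieces, (1.133) gives, entry by entry,
  G₀J = G′J + Σ_{y″} G′(piece), ∇G₀J = ∇G′J + Σ ∇G′(piece), ΔG₀J = ΔG′J + Σ ΔG′(piece) (pieces built from G₀J),
  G₀∇*J = G′∇*J + Σ G′(piece′), ∇G₀∇*J = ∇G′∇*J + Σ ∇G′(piece′) (pieces built from G₀∇*J), hence each sup /
  Hölder entry of Prop. 1.2 for G₀ at (J, y) is ≤ the same entry for G′ plus a sum over y″ of FIRST-ORDER entries of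
  G′ applied to the pieces (for the Hölder entry ‖ζG₀∇*J‖_α the piece term ‖ζG′(piece′)‖_α is bounded by the sup
  entries |G′(piece′)|, |∇G′(piece′)| on the cubes adjacent to Δ̃(y) — the lattice mean-value / product rule,
  constant `Dh`);
* `Carrier133` / `CarrierFacts` — the two abstract carriers `B5.Setting` of G′ and of G₀ describe the SAME torus:
  site / source / cut-off maps with the evident compatibilities, the finite unit lattice T₁ with its triangle
  inequality and finite neighbourhoods, cut-offs ζ_{y″} localized at y″ with |ζ_{y″}| ≤ 1, ‖J‖ ≤ B|J| for
  localized J, and the «weak bounds» in the only place they enter: the sup norm of a piece is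
  ≤ A·Σ_{w near y″} ‖ζ_{w}G₀J‖ (resp. ‖ζ_{w}G₀∇*J‖) — Cauchy–Schwarz for the block averages Q, Q′ (A absorbs a_k, a
  and the averaging weights), i.e. exactly the localized L² norms of (1.114) for G₀ (`B5.Local114Fam famG0`, the
  output of the previous printed step «This leads also to (1.114) …»);
* `URow` — row sums Σ_{y″∈T₁} e^{−κ|y−y″|} ≤ Λ(κ) of the unit lattice, for every κ > 0, uniformly in the family.

KERNEL-CHECKED: the exponential convolution on the unit lattice
Σ_{y″} e^{−δ₁|y−y″|}e^{−δ₂|y″−y′|} ≤ Λ(½δ)e^{−½δ|y−y′|} (δ = min of the rates) and all the constants, giving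
`firstOrder_transfer` (FirstOrderFam famG0), `secondOrder_transfer` (SecondOrderFam famG0),
`transfer_of_display133` (literally the hypothesis `transfer`), and the corollary `prop12G0_of_B4_via133` =
`B5Ineq110Gp.prop12G0_of_B4_via135` with `transfer` discharged: Proposition 1.2 for G₀ now rests on B4's Theorem
and Lemma 2.4 AS PRINTED, Prop. 1.1 and (1.114) for G₀ as the printed sentences they are, and located displays /
dictionaries only.

WHAT REMAINS A NAMED HYPOTHESIS (located, not proved): `Display133` (our entrywise weak form of (1.133) with the
cube decomposition — the identity (1.133) itself is printed, its use is not), `CarrierFacts` (model-evident facts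
about the torus, its cubes, the norms (1.108)–(1.109), the block averages), `URow`; and upstream everything listed
in `B5Ineq110Gp.prop12G0_of_B4_via135`.  No operator theory on the torus is formalised.  Nothing here is progress
on any Millennium problem: it is bookkeeping that turns the last informally juxtaposed sentence of the B4 → B5
interface for the sup / Hölder entries into kernel-checked arithmetic over located leaves.
-/

namespace Literature.MathematicalPhysics.QuantumFieldTheory.Balaban1983to89.B5Transfer133

open Finset B5FromB4

/-! ## §1. Real-arithmetic helpers -/

/-- Monotonicity of a three-factor product with non-negative factors. [folklore] -/
theorem mono3 {a b b' d d' : ℝ} (ha : 0 ≤ a) (hb : b ≤ b') (hb0 : 0 ≤ b) (hd : d ≤ d') (hd0 : 0 ≤ d) :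
    a * b * d ≤ a * b' * d' :=
  mul_le_mul (mul_le_mul_of_nonneg_left hb ha) hd hd0 (mul_nonneg ha (hb0.trans hb))

/-- Monotonicity of a four-factor product with non-negative factors. [folklore] -/
theorem mono4 {a b b' c c' d d' : ℝ} (ha : 0 ≤ a) (hb : b ≤ b') (hb0 : 0 ≤ b) (hc : c ≤ c') (hc0 : 0 ≤ c)
    (hd : d ≤ d') (hd0 : 0 ≤ d) : a * b * c * d ≤ a * b' * c' * d' :=
  mul_le_mul (mono3 ha hb hb0 hc hc0) hd hd0
    (mul_nonneg (mul_nonneg ha (hb0.trans hb)) (hc0.trans hc))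

/-- The two-rate exponential of the convolution: for 0 ≤ δ ≤ δ₁, δ₂, a, b ≥ 0 and t ≤ a + b (triangle inequality),
e^{−δ₁a}e^{−δ₂b} ≤ e^{−½δt}·e^{−½δa}. [folklore] -/
theorem exp_pair_le {δ δ₁ δ₂ a b t : ℝ} (hδ : 0 ≤ δ) (h1 : δ ≤ δ₁) (h2 : δ ≤ δ₂) (ha : 0 ≤ a) (hb : 0 ≤ b)
    (ht : t ≤ a + b) :
    Real.exp (-(δ₁ * a)) * Real.exp (-(δ₂ * b)) ≤ Real.exp (-(δ / 2 * t)) * Real.exp (-(δ / 2 * a)) := by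
  have hA : Real.exp (-(δ₁ * a)) ≤ Real.exp (-(δ * a)) := B9FromB6.decay_mono h1 ha
  have hB : Real.exp (-(δ₂ * b)) ≤ Real.exp (-(δ * b)) := B9FromB6.decay_mono h2 hb
  have hAB : Real.exp (-(δ₁ * a)) * Real.exp (-(δ₂ * b)) ≤ Real.exp (-(δ * a)) * Real.exp (-(δ * b)) :=
    mul_le_mul hA hB (Real.exp_nonneg _) (Real.exp_nonneg _)
  refine hAB.trans ?_
  rw [← Real.exp_add, ← Real.exp_add]
  apply Real.exp_le_exp.mpr
  have h3 : δ / 2 * t ≤ δ / 2 * (a + b) := mul_le_mul_of_nonneg_left ht (by linarith)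
  nlinarith [mul_nonneg hδ hb]

/-- The exponential convolution on a finite index set: Σ_{y″∈T} e^{−δ₁d(y,y″)}e^{−δ₂d(y″,y′)} ≤ Λ e^{−½δ d(y,y′)}
whenever 0 ≤ δ ≤ δ₁, δ₂, distances are non-negative, the triangle inequality holds through every y″, and the
½δ row sum at y is ≤ Λ. [folklore] -/
theorem conv_sum_le {X : Type} (T : Finset X) (d : X → X → ℝ) {δ δ₁ δ₂ Λ : ℝ} (y y' : X)
    (hδ : 0 ≤ δ) (h1 : δ ≤ δ₁) (h2 : δ ≤ δ₂) (hd : ∀ u v, 0 ≤ d u v)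
    (tri : ∀ y'', d y y' ≤ d y y'' + d y'' y')
    (row : ∑ y'' ∈ T, Real.exp (-(δ / 2 * d y y'')) ≤ Λ) :
    ∑ y'' ∈ T, Real.exp (-(δ₁ * d y y'')) * Real.exp (-(δ₂ * d y'' y')) ≤
      Λ * Real.exp (-(δ / 2 * d y y')) := by
  have hterm : ∀ y'' ∈ T, Real.exp (-(δ₁ * d y y'')) * Real.exp (-(δ₂ * d y'' y')) ≤
      Real.exp (-(δ / 2 * d y y')) * Real.exp (-(δ / 2 * d y y'')) :=
    fun y'' _ => exp_pair_le hδ h1 h2 (hd y y'') (hd y'' y') (tri y'')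
  calc ∑ y'' ∈ T, Real.exp (-(δ₁ * d y y'')) * Real.exp (-(δ₂ * d y'' y'))
      ≤ ∑ y'' ∈ T, Real.exp (-(δ / 2 * d y y')) * Real.exp (-(δ / 2 * d y y'')) := Finset.sum_le_sum hterm
    _ = Real.exp (-(δ / 2 * d y y')) * ∑ y'' ∈ T, Real.exp (-(δ / 2 * d y y'')) := by rw [Finset.mul_sum]
    _ ≤ Real.exp (-(δ / 2 * d y y')) * Λ := mul_le_mul_of_nonneg_left row (Real.exp_nonneg _)
    _ = Λ * Real.exp (-(δ / 2 * d y y')) := mul_comm _ _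

/-- A finite neighbourhood sum: if every term is ≤ M e^{−δ₂d(w,y′)} with d(y″,y′) − r ≤ d(w,y′) on the
neighbourhood, M ≥ 0, δ₂ ≥ 0, and the neighbourhood has ≤ N elements, the sum is ≤ N·M·e^{δ₂r}·e^{−δ₂d(y″,y′)}.
[folklore] -/
theorem nbr_sum_le {X : Type} (Nb : Finset X) (f : X → ℝ) {M δ₂ r N s : ℝ} (dd : X → ℝ)
    (hM : 0 ≤ M) (hδ₂ : 0 ≤ δ₂) (hN : (Nb.card : ℝ) ≤ N)
    (hf : ∀ w ∈ Nb, f w ≤ M * Real.exp (-(δ₂ * dd w)))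
    (hshift : ∀ w ∈ Nb, s - r ≤ dd w) :
    ∑ w ∈ Nb, f w ≤ N * (M * Real.exp (δ₂ * r) * Real.exp (-(δ₂ * s))) := by
  have hb : ∀ w ∈ Nb, f w ≤ M * Real.exp (δ₂ * r) * Real.exp (-(δ₂ * s)) := by
    intro w hw
    refine (hf w hw).trans ?_
    rw [mul_assoc]
    exact mul_le_mul_of_nonneg_left (exp_shift hδ₂ (hshift w hw)) hM
  have hb0 : 0 ≤ M * Real.exp (δ₂ * r) * Real.exp (-(δ₂ * s)) := by positivity
  calc ∑ w ∈ Nb, f w ≤ ∑ w ∈ Nb, M * Real.exp (δ₂ * r) * Real.exp (-(δ₂ * s)) := Finset.sum_le_sum hb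
    _ = Nb.card * (M * Real.exp (δ₂ * r) * Real.exp (-(δ₂ * s))) := by
        rw [Finset.sum_const, nsmul_eq_mul]
    _ ≤ N * (M * Real.exp (δ₂ * r) * Real.exp (-(δ₂ * s))) := mul_le_mul_of_nonneg_right hN hb0


/-! ## §2. The located leaves: carrier maps, the cube decomposition of (1.133), unit-lattice row sums -/

/-- Index bookkeeping of (1.133) for the four sup entries (n = 0, 1, 2, 3 ↔ G₀J, ∇G₀J, G₀∇*J, ΔG₀J): the G′-entry
acting on the pieces is G′·, ∇G′·, G′·, ΔG′· respectively (G₀∇*J = G′∇*J + G′V(G₀∇*J)).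
[cite: Balaban1984PropagatorsI, (1.133) p.39] -/
def mIdx : Fin 4 → Fin 4 := ![0, 1, 0, 3]

/-- Index bookkeeping of (1.133): the pieces are built from G₀J (L² entry 0 of (1.114)) for n = 0, 1, 3 and from
G₀∇*J (L² entry 2) for n = 2. [cite: Balaban1984PropagatorsI, (1.133) p.39] -/
def pIdx : Fin 4 → Fin 6 := ![0, 0, 2, 0]

/-- **Carrier of the transfer (data).**  The abstract settings `S'` (the operator G′ = G′_k) and `S₀` (the operator
G₀ = (Δ + aQ*Q)^{−1} of (1.132)) live on the same torus T_η with the same unit cubes, sources J, cut-offs ζ and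
norms; abstractly this is recorded by maps: `σ` on sites, `ι` on sources, `κ` on cut-offs; `T1` = the finite unit
lattice T₁^{(k)} indexing the cube decomposition VG₀J = Σ_{y″} 1_{Δ(y″)}VG₀J (V = a_kQ′*Q′ − aQ*Q); `nbr y` = the
unit-lattice points within a fixed distance of y; `ζ0 y″` = a cut-off localized at y″ with |ζ0 y″| ≤ 1;
`piece p J y″ : S'.Loc` = the source 1_{Δ(y″)}·V·(G₀^{(p)}J) seen by G′, where G₀^{(p)}J is the p-th of the six
operators of (1.114) applied to J (p = 0: G₀J; p = 2: G₀∇*J).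
[cite: Balaban1984PropagatorsI, (1.132)–(1.133) p.39] -/
structure Carrier133 (S' S₀ : B5.Setting) where
  σ : S₀.Site → S'.Site
  ι : S₀.Loc → S'.Loc
  κ : S₀.Cut → S'.Cut
  T1 : Finset S₀.Site
  nbr : S₀.Site → Finset S₀.Site
  ζ0 : S₀.Site → S₀.Cut
  piece : Fin 6 → S₀.Loc → S₀.Site → S'.Loc

variable {S' S₀ : B5.Setting}

/-- **Carrier facts (located leaf, model-evident except `piece_norm`).**  Compatibility of the maps with
distances, supports, cut-offs and norms (in the model all are identities); the unit-lattice triangle inequality;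
neighbourhoods of radius `r0` with at most `Nn` points; the cut-offs ζ_{y″} (supp ⊂ Δ̃(y″), |ζ_{y″}| ≤ 1);
‖J‖ ≤ B|J| for supp J ⊂ Δ̃(y′) (|Δ̃| = 2^d); and `piece_norm`: the sup norm of the cube piece
1_{Δ(y″)}(a_kQ′*Q′ − aQ*Q)(G₀^{(p)}J) is ≤ A·Σ_{w ∈ nbr y″} ‖ζ_{w}G₀^{(p)}J‖ — Cauchy–Schwarz for the block
averages Q, Q′ (unit blocks of η^d-measure 1, bounded averaging weights of finite range), A absorbing a_k, a and the
weights: this is WHERE the «weak bounds for G₀ … in the L²-norm … (1.114)» enter.  Not printed; located.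
[cite: Balaban1984PropagatorsI, (1.133) p.39, (1.108)–(1.109) p.35] -/
structure CarrierFacts (K : Carrier133 S' S₀) (A B r0 Nn : ℝ) : Prop where
  dist_le : ∀ y y' : S₀.Site, S₀.dist y y' ≤ S'.dist (K.σ y) (K.σ y')
  tri : ∀ y y'' y' : S₀.Site, S₀.dist y y' ≤ S₀.dist y y'' + S₀.dist y'' y'
  supp_map : ∀ (J : S₀.Loc) (y' : S₀.Site), S₀.suppIn J y' → S'.suppIn (K.ι J) (K.σ y')
  cut_map : ∀ (ζ : S₀.Cut) (y : S₀.Site), S₀.cutIn ζ y → S'.cutIn (K.κ ζ) (K.σ y)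
  supNorm_map : ∀ J : S₀.Loc, S'.supNorm (K.ι J) ≤ S₀.supNorm J
  holder_map : ∀ (ε : ℝ) (J : S₀.Loc), S'.holder ε (K.ι J) ≤ S₀.holder ε J
  cutH_map : ∀ (α : ℝ) (ζ : S₀.Cut), S'.cutH α (K.κ ζ) ≤ S₀.cutH α ζ
  nbr_dist : ∀ y w : S₀.Site, w ∈ K.nbr y → S₀.dist y w ≤ r0
  nbr_card : ∀ y : S₀.Site, ((K.nbr y).card : ℝ) ≤ Nn
  r0_nonneg : 0 ≤ r0
  Nn_nonneg : 0 ≤ Nn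
  ζ0_in : ∀ y : S₀.Site, S₀.cutIn (K.ζ0 y) y
  ζ0_sup : ∀ y : S₀.Site, S₀.cutSup (K.ζ0 y) ≤ 1
  piece_supp : ∀ (p : Fin 6) (J : S₀.Loc) (y'' : S₀.Site), y'' ∈ K.T1 → S'.suppIn (K.piece p J y'') (K.σ y'')
  piece_norm : ∀ (p : Fin 6) (J : S₀.Loc) (y'' : S₀.Site), y'' ∈ K.T1 →
    S'.supNorm (K.piece p J y'') ≤ A * ∑ w ∈ K.nbr y'', S₀.l2loc p J (K.ζ0 w)
  A_nonneg : 0 ≤ A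
  l2_le_sup : ∀ (J : S₀.Loc) (y' : S₀.Site), S₀.suppIn J y' → S₀.l2Norm J ≤ B * S₀.supNorm J
  B_nonneg : 0 ≤ B

/-- **The identity (1.133) entrywise, in weak form (located leaf).**  With V = a_kQ′*Q′ − aQ*Q and the cube pieces
of `Carrier133`: `sup` — |(G₀^{(n)}J)(x)| over Δ̃(y) ≤ the same G′ entry + Σ_{y″} the G′ entry `mIdx n` of the piece
`pIdx n` (G₀J = G′J + ΣG′(piece), ∇G₀J = ∇G′J + Σ∇G′(piece), G₀∇*J = G′∇*J + ΣG′(piece′), ΔG₀J = ΔG′J + ΣΔG′(piece));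
`h1` — max(‖ζ∇G₀J‖_α, ‖ζG₀∇*J‖_α) ≤ the G′ entry + Σ_{y″} [max-Hölder entry of G′ on the piece + Dh(‖ζ‖_α + |ζ|)·
Σ_{w ∈ nbr y}(|G′(piece′)| + |∇G′(piece′)|) over Δ̃(w)] (the Hölder quotient of ζ·G′(piece′) by the product rule and
the lattice mean-value inequality over the cubes adjacent to Δ̃(y) ⊇ supp ζ; max ≤ sum of the two non-negative bounds);
`e4` — |∇G₀∇*J| ≤ |∇G′∇*J| + Σ|∇G′(piece′)|; `h2` — ‖ζ∇G₀∇*J‖_α ≤ ‖ζ∇G′∇*J‖_α + Σ max-Hölder entry of G′ on piece′.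
OUR READING of «easily reduced to the corresponding properties of the operator G′ by the equality (1.133)»; the
identity is printed, this use of it is not. [cite: Balaban1984PropagatorsI, (1.133) p.39] -/
structure Display133 (K : Carrier133 S' S₀) (Dh : ℝ) : Prop where
  sup : ∀ (n : Fin 4) (J : S₀.Loc) (y : S₀.Site),
    S₀.e n J y ≤ S'.e n (K.ι J) (K.σ y) + ∑ y'' ∈ K.T1, S'.e (mIdx n) (K.piece (pIdx n) J y'') (K.σ y)
  h1 : ∀ (J : S₀.Loc) (α : ℝ) (ζ : S₀.Cut) (y : S₀.Site), S₀.cutIn ζ y →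
    S₀.h1 J α ζ ≤ S'.h1 (K.ι J) α (K.κ ζ) + ∑ y'' ∈ K.T1, (S'.h1 (K.piece 0 J y'') α (K.κ ζ) +
      Dh * S₀.cutH α ζ * ∑ w ∈ K.nbr y, (S'.e 0 (K.piece 2 J y'') (K.σ w) + S'.e 1 (K.piece 2 J y'') (K.σ w)))
  Dh_nonneg : 0 ≤ Dh
  e4 : ∀ (J : S₀.Loc) (y : S₀.Site),
    S₀.e4 J y ≤ S'.e4 (K.ι J) (K.σ y) + ∑ y'' ∈ K.T1, S'.e 1 (K.piece 2 J y'') (K.σ y)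
  h2 : ∀ (J : S₀.Loc) (α : ℝ) (ζ : S₀.Cut) (y : S₀.Site), S₀.cutIn ζ y →
    S₀.h2 J α ζ ≤ S'.h2 (K.ι J) α (K.κ ζ) + ∑ y'' ∈ K.T1, S'.h1 (K.piece 2 J y'') α (K.κ ζ)

/-- Row sums of the unit lattice T₁^{(k)} at rate κ: Σ_{y″∈T₁} e^{−κ|y−y″|} ≤ Λ (model-evident for every κ > 0 with
Λ = Λ(κ, d) uniform in the torus). [folklore] -/
def URow (K : Carrier133 S' S₀) (κ Λ : ℝ) : Prop :=
  ∀ y : S₀.Site, ∑ y'' ∈ K.T1, Real.exp (-(κ * S₀.dist y y'')) ≤ Λ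


/-! ## §3. One instance: the pieces, the convolution, the four kinds of entries -/

section Instance

variable (K : Carrier133 S' S₀) {A B r0 Nn Dh : ℝ}

/-- The «weak bounds» at work: the sup norm of a cube piece is exponentially small in |y″ − y′| by the localized L²
bound (1.114) for G₀ (entry p, constant C₂, rate δ₂), Cauchy–Schwarz (A) and ‖J‖ ≤ B|J|; the finite neighbourhood
costs the factor Nn·e^{δ₂r0}. [cite: Balaban1984PropagatorsI, (1.133) and «weak bounds … (1.114)» p.39] -/
theorem piece_norm_le (Fk : CarrierFacts K A B r0 Nn) (Sg₀ : ModelSigns S₀) {C₂ δ₂ : ℝ} (hC₂ : 0 ≤ C₂)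
    (hδ₂ : 0 ≤ δ₂) (p : Fin 6) (Hl2 : L2Entry S₀ p C₂ δ₂) (J : S₀.Loc) (y' y'' : S₀.Site)
    (hs : S₀.suppIn J y') (hy'' : y'' ∈ K.T1) :
    S'.supNorm (K.piece p J y'') ≤
      A * Nn * C₂ * B * Real.exp (δ₂ * r0) * Real.exp (-(δ₂ * S₀.dist y'' y')) * S₀.supNorm J := by
  have hJ0 : 0 ≤ S₀.supNorm J := Sg₀.supNorm_nonneg J
  have hB0 : 0 ≤ B := Fk.B_nonneg
  have hterm : ∀ w ∈ K.nbr y'',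
      S₀.l2loc p J (K.ζ0 w) ≤ C₂ * B * S₀.supNorm J * Real.exp (-(δ₂ * S₀.dist w y')) := by
    intro w _
    have hl := Hl2 J (K.ζ0 w) w y' (Fk.ζ0_in w) hs
    have h1 : C₂ * Real.exp (-(δ₂ * S₀.dist w y')) * S₀.cutSup (K.ζ0 w) * S₀.l2Norm J ≤
        C₂ * Real.exp (-(δ₂ * S₀.dist w y')) * 1 * (B * S₀.supNorm J) :=
      mul_le_mul (mul_le_mul_of_nonneg_left (Fk.ζ0_sup w) (mul_nonneg hC₂ (Real.exp_nonneg _)))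
        (Fk.l2_le_sup J y' hs) (Sg₀.l2Norm_nonneg J) (by positivity)
    calc S₀.l2loc p J (K.ζ0 w) ≤ _ := hl
      _ ≤ C₂ * Real.exp (-(δ₂ * S₀.dist w y')) * 1 * (B * S₀.supNorm J) := h1
      _ = C₂ * B * S₀.supNorm J * Real.exp (-(δ₂ * S₀.dist w y')) := by ring
  have hshift : ∀ w ∈ K.nbr y'', S₀.dist y'' y' - r0 ≤ S₀.dist w y' := by
    intro w hw
    have h1 := Fk.tri y'' w y'
    have h2 := Fk.nbr_dist y'' w hw
    linarith
  have hsum := nbr_sum_le (K.nbr y'') (fun w => S₀.l2loc p J (K.ζ0 w)) (fun w => S₀.dist w y')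
    (by positivity : 0 ≤ C₂ * B * S₀.supNorm J) hδ₂ (Fk.nbr_card y'') hterm hshift
  calc S'.supNorm (K.piece p J y'') ≤ A * ∑ w ∈ K.nbr y'', S₀.l2loc p J (K.ζ0 w) := Fk.piece_norm p J y'' hy''
    _ ≤ A * (Nn * (C₂ * B * S₀.supNorm J * Real.exp (δ₂ * r0) * Real.exp (-(δ₂ * S₀.dist y'' y')))) :=
        mul_le_mul_of_nonneg_left hsum Fk.A_nonneg
    _ = A * Nn * C₂ * B * Real.exp (δ₂ * r0) * Real.exp (-(δ₂ * S₀.dist y'' y')) * S₀.supNorm J := by ring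

/-- A first-order sup entry of G′ (constant C₁, rate δ₁) applied to a cube piece, evaluated over Δ̃(z) for a unit
point z with |y − y″| − r ≤ |z − y″| (z = y with r = 0, or z adjacent to y with r = r0):
≤ C₁e^{δ₁r}e^{−δ₁|y−y″|}·(A·Nn·C₂·B·e^{δ₂r0})e^{−δ₂|y″−y′|}|J|.
[cite: Balaban1984PropagatorsI, (1.133), (1.110) pp.35,39] -/
theorem sup_piece_le (Fk : CarrierFacts K A B r0 Nn) (Sg' : ModelSigns S') (Sg₀ : ModelSigns S₀)
    {C₁ δ₁ C₂ δ₂ : ℝ} (hC₁ : 0 ≤ C₁) (hδ₁ : 0 ≤ δ₁) (hC₂ : 0 ≤ C₂) (hδ₂ : 0 ≤ δ₂) (m : Fin 4) (p : Fin 6)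
    (He : SupEntry S' m C₁ δ₁) (Hl2 : L2Entry S₀ p C₂ δ₂) (J : S₀.Loc) (y y' y'' z : S₀.Site) (r : ℝ)
    (hs : S₀.suppIn J y') (hy'' : y'' ∈ K.T1) (hz : S₀.dist y y'' - r ≤ S₀.dist z y'') :
    S'.e m (K.piece p J y'') (K.σ z) ≤
      C₁ * Real.exp (δ₁ * r) * Real.exp (-(δ₁ * S₀.dist y y'')) *
        (A * Nn * C₂ * B * Real.exp (δ₂ * r0) * Real.exp (-(δ₂ * S₀.dist y'' y')) * S₀.supNorm J) := by
  have h0 := He (K.piece p J y'') (K.σ z) (K.σ y'') (Fk.piece_supp p J y'' hy'')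
  have hD : Real.exp (-(δ₁ * S'.dist (K.σ z) (K.σ y''))) ≤ Real.exp (-(δ₁ * S₀.dist z y'')) :=
    Real.exp_le_exp.mpr (neg_le_neg (mul_le_mul_of_nonneg_left (Fk.dist_le z y'') hδ₁))
  have hD' : Real.exp (-(δ₁ * S₀.dist z y'')) ≤ Real.exp (δ₁ * r) * Real.exp (-(δ₁ * S₀.dist y y'')) :=
    exp_shift hδ₁ hz
  have hP := piece_norm_le K Fk Sg₀ hC₂ hδ₂ p Hl2 J y' y'' hs hy''
  calc S'.e m (K.piece p J y'') (K.σ z)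
      ≤ C₁ * Real.exp (-(δ₁ * S'.dist (K.σ z) (K.σ y''))) * S'.supNorm (K.piece p J y'') := h0
    _ ≤ C₁ * (Real.exp (δ₁ * r) * Real.exp (-(δ₁ * S₀.dist y y''))) *
          (A * Nn * C₂ * B * Real.exp (δ₂ * r0) * Real.exp (-(δ₂ * S₀.dist y'' y')) * S₀.supNorm J) :=
        mono3 hC₁ (hD.trans hD') (Real.exp_nonneg _) hP (Sg'.supNorm_nonneg _)
    _ = _ := by ring

/-- The sum over the cube decomposition of a first-order G′ entry of the pieces, at y itself:
Σ_{y″∈T₁} ≤ C₁·P·Λ·e^{−½δ|y−y′|}|J| with P = A·Nn·C₂·B·e^{δ₂r0}, δ ≤ δ₁, δ₂ and Λ the ½δ row sum.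
[cite: Balaban1984PropagatorsI, (1.133) p.39] -/
theorem sum_sup_piece_le (Fk : CarrierFacts K A B r0 Nn) (Sg' : ModelSigns S') (Sg₀ : ModelSigns S₀)
    {C₁ δ₁ C₂ δ₂ δ Λ : ℝ} (hC₁ : 0 ≤ C₁) (hC₂ : 0 ≤ C₂) (hδ : 0 ≤ δ) (h1 : δ ≤ δ₁) (h2 : δ ≤ δ₂)
    (m : Fin 4) (p : Fin 6) (He : SupEntry S' m C₁ δ₁) (Hl2 : L2Entry S₀ p C₂ δ₂) (row : URow K (δ / 2) Λ)
    (J : S₀.Loc) (y y' : S₀.Site) (hs : S₀.suppIn J y') :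
    ∑ y'' ∈ K.T1, S'.e m (K.piece p J y'') (K.σ y) ≤
      C₁ * (A * Nn * C₂ * B * Real.exp (δ₂ * r0)) * Λ * Real.exp (-(δ / 2 * S₀.dist y y')) * S₀.supNorm J := by
  have hδ₁ : 0 ≤ δ₁ := hδ.trans h1
  have hδ₂ : 0 ≤ δ₂ := hδ.trans h2
  have hterm : ∀ y'' ∈ K.T1, S'.e m (K.piece p J y'') (K.σ y) ≤
      C₁ * (A * Nn * C₂ * B * Real.exp (δ₂ * r0)) * S₀.supNorm J *
        (Real.exp (-(δ₁ * S₀.dist y y'')) * Real.exp (-(δ₂ * S₀.dist y'' y'))) := by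
    intro y'' hy''
    have h := sup_piece_le K Fk Sg' Sg₀ hC₁ hδ₁ hC₂ hδ₂ m p He Hl2 J y y' y'' y 0 hs hy'' (by linarith)
    rw [mul_zero, Real.exp_zero, mul_one] at h
    refine h.trans (le_of_eq ?_)
    ring
  have hconv := conv_sum_le K.T1 S₀.dist y y' hδ h1 h2 Sg₀.dist_nonneg (fun y'' => Fk.tri y y'' y') (row y)
  have hc0 : 0 ≤ C₁ * (A * Nn * C₂ * B * Real.exp (δ₂ * r0)) * S₀.supNorm J := by
    have := Fk.A_nonneg; have := Fk.Nn_nonneg; have := Fk.B_nonneg; have := Sg₀.supNorm_nonneg J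
    positivity
  calc ∑ y'' ∈ K.T1, S'.e m (K.piece p J y'') (K.σ y)
      ≤ ∑ y'' ∈ K.T1, C₁ * (A * Nn * C₂ * B * Real.exp (δ₂ * r0)) * S₀.supNorm J *
          (Real.exp (-(δ₁ * S₀.dist y y'')) * Real.exp (-(δ₂ * S₀.dist y'' y'))) := Finset.sum_le_sum hterm
    _ = C₁ * (A * Nn * C₂ * B * Real.exp (δ₂ * r0)) * S₀.supNorm J *
          ∑ y'' ∈ K.T1, Real.exp (-(δ₁ * S₀.dist y y'')) * Real.exp (-(δ₂ * S₀.dist y'' y')) := by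
        rw [Finset.mul_sum]
    _ ≤ C₁ * (A * Nn * C₂ * B * Real.exp (δ₂ * r0)) * S₀.supNorm J *
          (Λ * Real.exp (-(δ / 2 * S₀.dist y y'))) := mul_le_mul_of_nonneg_left hconv hc0
    _ = _ := by ring

/-- The neighbourhood version for the Hölder entry of ζG′(piece′):
Σ_{y″∈T₁} Σ_{w ∈ nbr y} (|G′(piece′)| + |∇G′(piece′)|) over Δ̃(w) ≤ 2·Nn·C₁e^{δ₁r0}·P·Λ·e^{−½δ|y−y′|}|J|.
[cite: Balaban1984PropagatorsI, (1.133) p.39] -/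
theorem sum_nbr_piece_le (Fk : CarrierFacts K A B r0 Nn) (Sg' : ModelSigns S') (Sg₀ : ModelSigns S₀)
    {C₁ δ₁ C₂ δ₂ δ Λ : ℝ} (hC₁ : 0 ≤ C₁) (hC₂ : 0 ≤ C₂) (hδ : 0 ≤ δ) (h1 : δ ≤ δ₁) (h2 : δ ≤ δ₂)
    (He0 : SupEntry S' 0 C₁ δ₁) (He1 : SupEntry S' 1 C₁ δ₁) (Hl2 : L2Entry S₀ 2 C₂ δ₂)
    (row : URow K (δ / 2) Λ) (J : S₀.Loc) (y y' : S₀.Site) (hs : S₀.suppIn J y') :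
    ∑ y'' ∈ K.T1, ∑ w ∈ K.nbr y, (S'.e 0 (K.piece 2 J y'') (K.σ w) + S'.e 1 (K.piece 2 J y'') (K.σ w)) ≤
      2 * Nn * (C₁ * Real.exp (δ₁ * r0)) * (A * Nn * C₂ * B * Real.exp (δ₂ * r0)) * Λ *
        Real.exp (-(δ / 2 * S₀.dist y y')) * S₀.supNorm J := by
  have hδ₁ : 0 ≤ δ₁ := hδ.trans h1
  have hδ₂ : 0 ≤ δ₂ := hδ.trans h2
  obtain ⟨P, hP⟩ : ∃ P : ℝ, P = A * Nn * C₂ * B * Real.exp (δ₂ * r0) := ⟨_, rfl⟩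
  have hP0 : 0 ≤ P := by
    rw [hP]; have := Fk.A_nonneg; have := Fk.Nn_nonneg; have := Fk.B_nonneg; positivity
  have hJ0 := Sg₀.supNorm_nonneg J
  -- each inner term
  have hinner : ∀ y'' ∈ K.T1, ∀ w ∈ K.nbr y,
      S'.e 0 (K.piece 2 J y'') (K.σ w) + S'.e 1 (K.piece 2 J y'') (K.σ w) ≤
        2 * (C₁ * Real.exp (δ₁ * r0)) * P * S₀.supNorm J *
          (Real.exp (-(δ₁ * S₀.dist y y'')) * Real.exp (-(δ₂ * S₀.dist y'' y'))) := by
    intro y'' hy'' w hw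
    have hz : S₀.dist y y'' - r0 ≤ S₀.dist w y'' := by
      have t1 := Fk.tri y w y''
      have t2 := Fk.nbr_dist y w hw
      linarith
    have a0 := sup_piece_le K Fk Sg' Sg₀ hC₁ hδ₁ hC₂ hδ₂ 0 2 He0 Hl2 J y y' y'' w r0 hs hy'' hz
    have a1 := sup_piece_le K Fk Sg' Sg₀ hC₁ hδ₁ hC₂ hδ₂ 1 2 He1 Hl2 J y y' y'' w r0 hs hy'' hz
    rw [← hP] at a0 a1
    have := add_le_add a0 a1
    refine this.trans (le_of_eq ?_)
    ring
  have hmid : ∀ y'' ∈ K.T1,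
      ∑ w ∈ K.nbr y, (S'.e 0 (K.piece 2 J y'') (K.σ w) + S'.e 1 (K.piece 2 J y'') (K.σ w)) ≤
        Nn * (2 * (C₁ * Real.exp (δ₁ * r0)) * P * S₀.supNorm J *
          (Real.exp (-(δ₁ * S₀.dist y y'')) * Real.exp (-(δ₂ * S₀.dist y'' y')))) := by
    intro y'' hy''
    have hb0 : 0 ≤ 2 * (C₁ * Real.exp (δ₁ * r0)) * P * S₀.supNorm J *
        (Real.exp (-(δ₁ * S₀.dist y y'')) * Real.exp (-(δ₂ * S₀.dist y'' y'))) := by positivity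
    calc ∑ w ∈ K.nbr y, (S'.e 0 (K.piece 2 J y'') (K.σ w) + S'.e 1 (K.piece 2 J y'') (K.σ w))
        ≤ ∑ w ∈ K.nbr y, 2 * (C₁ * Real.exp (δ₁ * r0)) * P * S₀.supNorm J *
            (Real.exp (-(δ₁ * S₀.dist y y'')) * Real.exp (-(δ₂ * S₀.dist y'' y'))) :=
          Finset.sum_le_sum (hinner y'' hy'')
      _ = (K.nbr y).card * (2 * (C₁ * Real.exp (δ₁ * r0)) * P * S₀.supNorm J *
            (Real.exp (-(δ₁ * S₀.dist y y'')) * Real.exp (-(δ₂ * S₀.dist y'' y')))) := by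
          rw [Finset.sum_const, nsmul_eq_mul]
      _ ≤ _ := mul_le_mul_of_nonneg_right (Fk.nbr_card y) hb0
  have hconv := conv_sum_le K.T1 S₀.dist y y' hδ h1 h2 Sg₀.dist_nonneg (fun y'' => Fk.tri y y'' y') (row y)
  have hc0 : 0 ≤ Nn * (2 * (C₁ * Real.exp (δ₁ * r0)) * P * S₀.supNorm J) := by
    have := Fk.Nn_nonneg; positivity
  calc ∑ y'' ∈ K.T1, ∑ w ∈ K.nbr y, (S'.e 0 (K.piece 2 J y'') (K.σ w) + S'.e 1 (K.piece 2 J y'') (K.σ w))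
      ≤ ∑ y'' ∈ K.T1, Nn * (2 * (C₁ * Real.exp (δ₁ * r0)) * P * S₀.supNorm J *
          (Real.exp (-(δ₁ * S₀.dist y y'')) * Real.exp (-(δ₂ * S₀.dist y'' y')))) := Finset.sum_le_sum hmid
    _ = Nn * (2 * (C₁ * Real.exp (δ₁ * r0)) * P * S₀.supNorm J) *
          ∑ y'' ∈ K.T1, Real.exp (-(δ₁ * S₀.dist y y'')) * Real.exp (-(δ₂ * S₀.dist y'' y')) := by
        rw [Finset.mul_sum]; refine Finset.sum_congr rfl fun y'' _ => ?_; ring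
    _ ≤ Nn * (2 * (C₁ * Real.exp (δ₁ * r0)) * P * S₀.supNorm J) *
          (Λ * Real.exp (-(δ / 2 * S₀.dist y y'))) := mul_le_mul_of_nonneg_left hconv hc0
    _ = _ := by rw [hP]; ring

/-- The sum over the cube decomposition of the max-Hölder entry (1.111) of G′ (constant Cα(α), rate δ₁) applied to
the pieces: Σ_{y″∈T₁} ≤ max(Cα(α),0)·P·Λ·e^{−½δ|y−y′|}(‖ζ‖_α + |ζ|)|J|.
[cite: Balaban1984PropagatorsI, (1.133), (1.111) pp.35,39] -/
theorem sum_h1_piece_le (Fk : CarrierFacts K A B r0 Nn) (Sg' : ModelSigns S') (Sg₀ : ModelSigns S₀)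
    {Cα : ℝ → ℝ} {δ₁ C₂ δ₂ δ Λ : ℝ} (hC₂ : 0 ≤ C₂) (hδ : 0 ≤ δ) (h1 : δ ≤ δ₁) (h2 : δ ≤ δ₂) (p : Fin 6)
    (Hh1 : H1Entry S' Cα δ₁) (Hl2 : L2Entry S₀ p C₂ δ₂) (row : URow K (δ / 2) Λ)
    (α : ℝ) (J : S₀.Loc) (ζ : S₀.Cut) (y y' : S₀.Site) (hα0 : 0 ≤ α) (hα1 : α < 1) (hζ : S₀.cutIn ζ y)
    (hs : S₀.suppIn J y') :
    ∑ y'' ∈ K.T1, S'.h1 (K.piece p J y'') α (K.κ ζ) ≤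
      max (Cα α) 0 * (A * Nn * C₂ * B * Real.exp (δ₂ * r0)) * Λ * Real.exp (-(δ / 2 * S₀.dist y y')) *
        S₀.cutH α ζ * S₀.supNorm J := by
  have hδ₁ : 0 ≤ δ₁ := hδ.trans h1
  have hδ₂ : 0 ≤ δ₂ := hδ.trans h2
  obtain ⟨P, hP⟩ : ∃ P : ℝ, P = A * Nn * C₂ * B * Real.exp (δ₂ * r0) := ⟨_, rfl⟩
  have hP0 : 0 ≤ P := by
    rw [hP]; have := Fk.A_nonneg; have := Fk.Nn_nonneg; have := Fk.B_nonneg; positivity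
  have hJ0 := Sg₀.supNorm_nonneg J
  have hH0 := Sg₀.cutH_nonneg α ζ
  have hCa0 : 0 ≤ max (Cα α) 0 := le_max_right _ _
  have hterm : ∀ y'' ∈ K.T1, S'.h1 (K.piece p J y'') α (K.κ ζ) ≤
      max (Cα α) 0 * P * S₀.cutH α ζ * S₀.supNorm J *
        (Real.exp (-(δ₁ * S₀.dist y y'')) * Real.exp (-(δ₂ * S₀.dist y'' y'))) := by
    intro y'' hy''
    have h0 := Hh1 α (K.piece p J y'') (K.κ ζ) (K.σ y) (K.σ y'') hα0 hα1 (Fk.cut_map ζ y hζ)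
      (Fk.piece_supp p J y'' hy'')
    -- replace Cα by max (Cα) 0, the S'-distance by the S₀-distance, the S'-cutH by the S₀ one, the piece norm
    have hD : Real.exp (-(δ₁ * S'.dist (K.σ y) (K.σ y''))) ≤ Real.exp (-(δ₁ * S₀.dist y y'')) :=
      Real.exp_le_exp.mpr (neg_le_neg (mul_le_mul_of_nonneg_left (Fk.dist_le y y'') hδ₁))
    have hPc := piece_norm_le K Fk Sg₀ hC₂ hδ₂ p Hl2 J y' y'' hs hy''
    rw [← hP] at hPc
    have step1 : Cα α * Real.exp (-(δ₁ * S'.dist (K.σ y) (K.σ y''))) * S'.cutH α (K.κ ζ) *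
        S'.supNorm (K.piece p J y'') ≤ max (Cα α) 0 * Real.exp (-(δ₁ * S'.dist (K.σ y) (K.σ y''))) *
        S'.cutH α (K.κ ζ) * S'.supNorm (K.piece p J y'') :=
      mul_le_mul_of_nonneg_right (mul_le_mul_of_nonneg_right (mul_le_mul_of_nonneg_right (le_max_left _ _)
        (Real.exp_nonneg _)) (Sg'.cutH_nonneg _ _)) (Sg'.supNorm_nonneg _)
    have step2 : max (Cα α) 0 * Real.exp (-(δ₁ * S'.dist (K.σ y) (K.σ y''))) * S'.cutH α (K.κ ζ) *
        S'.supNorm (K.piece p J y'') ≤ max (Cα α) 0 * Real.exp (-(δ₁ * S₀.dist y y'')) * S₀.cutH α ζ *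
        (P * Real.exp (-(δ₂ * S₀.dist y'' y')) * S₀.supNorm J) :=
      mono4 hCa0 hD (Real.exp_nonneg _) (Fk.cutH_map α ζ) (Sg'.cutH_nonneg _ _) hPc (Sg'.supNorm_nonneg _)
    refine (h0.trans (step1.trans step2)).trans (le_of_eq ?_)
    ring
  have hconv := conv_sum_le K.T1 S₀.dist y y' hδ h1 h2 Sg₀.dist_nonneg (fun y'' => Fk.tri y y'' y') (row y)
  have hc0 : 0 ≤ max (Cα α) 0 * P * S₀.cutH α ζ * S₀.supNorm J := by positivity
  calc ∑ y'' ∈ K.T1, S'.h1 (K.piece p J y'') α (K.κ ζ)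
      ≤ ∑ y'' ∈ K.T1, max (Cα α) 0 * P * S₀.cutH α ζ * S₀.supNorm J *
          (Real.exp (-(δ₁ * S₀.dist y y'')) * Real.exp (-(δ₂ * S₀.dist y'' y'))) := Finset.sum_le_sum hterm
    _ = max (Cα α) 0 * P * S₀.cutH α ζ * S₀.supNorm J *
          ∑ y'' ∈ K.T1, Real.exp (-(δ₁ * S₀.dist y y'')) * Real.exp (-(δ₂ * S₀.dist y'' y')) := by
        rw [Finset.mul_sum]
    _ ≤ max (Cα α) 0 * P * S₀.cutH α ζ * S₀.supNorm J * (Λ * Real.exp (-(δ / 2 * S₀.dist y y'))) :=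
        mul_le_mul_of_nonneg_left hconv hc0
    _ = _ := by rw [hP]; ring

/-- Rate bookkeeping: for 0 ≤ δ ≤ δ₁ and 0 ≤ d ≤ D, e^{−δ₁D} ≤ e^{−½δ d}. [folklore] -/
theorem decay_transfer {δ δ₁ d D : ℝ} (hδ : 0 ≤ δ) (h1 : δ ≤ δ₁) (hd : 0 ≤ d) (hdD : d ≤ D) :
    Real.exp (-(δ₁ * D)) ≤ Real.exp (-(δ / 2 * d)) := by
  apply Real.exp_le_exp.mpr
  apply neg_le_neg
  calc δ / 2 * d ≤ δ₁ * d := mul_le_mul_of_nonneg_right (by linarith) hd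
    _ ≤ δ₁ * D := mul_le_mul_of_nonneg_left hdD (hδ.trans h1)

/-- **(1.110) for G₀ from (1.110) for G′ and (1.114) for G₀**, one instance, sup entry n, with explicit constant
C₁ + C₁·P·Λ and rate ½δ (δ ≤ the rates of G′ and of (1.114), Λ = the ½δ row sum, P = A·Nn·C₂·B·e^{δ₂r0}).
[cite: Balaban1984PropagatorsI, (1.133) p.39, (1.110) p.35] -/
theorem supEntry_G0 (Fk : CarrierFacts K A B r0 Nn) (Dp : Display133 K Dh) (Sg' : ModelSigns S')
    (Sg₀ : ModelSigns S₀) {C₁ δ₁ C₂ δ₂ δ Λ : ℝ} (hC₁ : 0 ≤ C₁) (hC₂ : 0 ≤ C₂) (hδ : 0 ≤ δ) (h1 : δ ≤ δ₁)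
    (h2 : δ ≤ δ₂) (He : ∀ n, SupEntry S' n C₁ δ₁) (Hl2 : ∀ p, L2Entry S₀ p C₂ δ₂) (row : URow K (δ / 2) Λ)
    (n : Fin 4) :
    SupEntry S₀ n (C₁ + C₁ * (A * Nn * C₂ * B * Real.exp (δ₂ * r0)) * Λ) (δ / 2) := by
  intro J y y' hs
  have hmain := He n (K.ι J) (K.σ y) (K.σ y') (Fk.supp_map J y' hs)
  have hD : Real.exp (-(δ₁ * S'.dist (K.σ y) (K.σ y'))) ≤ Real.exp (-(δ / 2 * S₀.dist y y')) :=
    decay_transfer hδ h1 (Sg₀.dist_nonneg y y') (Fk.dist_le y y')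
  have h1' : C₁ * Real.exp (-(δ₁ * S'.dist (K.σ y) (K.σ y'))) * S'.supNorm (K.ι J) ≤
      C₁ * Real.exp (-(δ / 2 * S₀.dist y y')) * S₀.supNorm J :=
    mono3 hC₁ hD (Real.exp_nonneg _) (Fk.supNorm_map J) (Sg'.supNorm_nonneg _)
  have hsum := sum_sup_piece_le K Fk Sg' Sg₀ hC₁ hC₂ hδ h1 h2 (mIdx n) (pIdx n) (He _) (Hl2 _) row J y y' hs
  calc S₀.e n J y ≤ _ := Dp.sup n J y
    _ ≤ C₁ * Real.exp (-(δ / 2 * S₀.dist y y')) * S₀.supNorm J +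
        C₁ * (A * Nn * C₂ * B * Real.exp (δ₂ * r0)) * Λ * Real.exp (-(δ / 2 * S₀.dist y y')) * S₀.supNorm J :=
        add_le_add (hmain.trans h1') hsum
    _ = _ := by ring

/-- **(1.111) for G₀ from (1.110)–(1.111) for G′ and (1.114) for G₀**, one instance, with explicit constant
α ↦ Cα⁺ + Cα⁺·P·Λ + Dh·(2·Nn·C₁e^{δ₁r0}·P·Λ) (Cα⁺ = max(Cα(α),0)) and rate ½δ.
[cite: Balaban1984PropagatorsI, (1.133) p.39, (1.111) p.35] -/
theorem h1Entry_G0 (Fk : CarrierFacts K A B r0 Nn) (Dp : Display133 K Dh) (Sg' : ModelSigns S')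
    (Sg₀ : ModelSigns S₀) {Cα : ℝ → ℝ} {C₁ δ₁ C₂ δ₂ δ Λ : ℝ} (hC₁ : 0 ≤ C₁) (hC₂ : 0 ≤ C₂) (hδ : 0 ≤ δ)
    (h1 : δ ≤ δ₁) (h2 : δ ≤ δ₂) (He : ∀ n, SupEntry S' n C₁ δ₁) (Hh1 : H1Entry S' Cα δ₁)
    (Hl2 : ∀ p, L2Entry S₀ p C₂ δ₂) (row : URow K (δ / 2) Λ) :
    H1Entry S₀ (fun α => max (Cα α) 0 + max (Cα α) 0 * (A * Nn * C₂ * B * Real.exp (δ₂ * r0)) * Λ +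
      Dh * (2 * Nn * (C₁ * Real.exp (δ₁ * r0)) * (A * Nn * C₂ * B * Real.exp (δ₂ * r0)) * Λ)) (δ / 2) := by
  intro α J ζ y y' hα0 hα1 hζ hs
  have hCa0 : 0 ≤ max (Cα α) 0 := le_max_right _ _
  have hmain := Hh1 α (K.ι J) (K.κ ζ) (K.σ y) (K.σ y') hα0 hα1 (Fk.cut_map ζ y hζ) (Fk.supp_map J y' hs)
  have hD : Real.exp (-(δ₁ * S'.dist (K.σ y) (K.σ y'))) ≤ Real.exp (-(δ / 2 * S₀.dist y y')) :=
    decay_transfer hδ h1 (Sg₀.dist_nonneg y y') (Fk.dist_le y y')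
  have step1 : Cα α * Real.exp (-(δ₁ * S'.dist (K.σ y) (K.σ y'))) * S'.cutH α (K.κ ζ) * S'.supNorm (K.ι J) ≤
      max (Cα α) 0 * Real.exp (-(δ₁ * S'.dist (K.σ y) (K.σ y'))) * S'.cutH α (K.κ ζ) * S'.supNorm (K.ι J) :=
    mul_le_mul_of_nonneg_right (mul_le_mul_of_nonneg_right (mul_le_mul_of_nonneg_right (le_max_left _ _)
      (Real.exp_nonneg _)) (Sg'.cutH_nonneg _ _)) (Sg'.supNorm_nonneg _)
  have step2 : max (Cα α) 0 * Real.exp (-(δ₁ * S'.dist (K.σ y) (K.σ y'))) * S'.cutH α (K.κ ζ) *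
      S'.supNorm (K.ι J) ≤ max (Cα α) 0 * Real.exp (-(δ / 2 * S₀.dist y y')) * S₀.cutH α ζ * S₀.supNorm J :=
    mono4 hCa0 hD (Real.exp_nonneg _) (Fk.cutH_map α ζ) (Sg'.cutH_nonneg _ _) (Fk.supNorm_map J)
      (Sg'.supNorm_nonneg _)
  have hA := sum_h1_piece_le K Fk Sg' Sg₀ hC₂ hδ h1 h2 0 Hh1 (Hl2 0) row α J ζ y y' hα0 hα1 hζ hs
  have hB := sum_nbr_piece_le K Fk Sg' Sg₀ hC₁ hC₂ hδ h1 h2 (He 0) (He 1) (Hl2 2) row J y y' hs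
  have hB' : Dh * S₀.cutH α ζ *
      ∑ y'' ∈ K.T1, ∑ w ∈ K.nbr y, (S'.e 0 (K.piece 2 J y'') (K.σ w) + S'.e 1 (K.piece 2 J y'') (K.σ w)) ≤
      Dh * S₀.cutH α ζ * (2 * Nn * (C₁ * Real.exp (δ₁ * r0)) * (A * Nn * C₂ * B * Real.exp (δ₂ * r0)) * Λ *
        Real.exp (-(δ / 2 * S₀.dist y y')) * S₀.supNorm J) :=
    mul_le_mul_of_nonneg_left hB (mul_nonneg Dp.Dh_nonneg (Sg₀.cutH_nonneg α ζ))
  have hsplit : ∑ y'' ∈ K.T1, (S'.h1 (K.piece 0 J y'') α (K.κ ζ) + Dh * S₀.cutH α ζ *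
      ∑ w ∈ K.nbr y, (S'.e 0 (K.piece 2 J y'') (K.σ w) + S'.e 1 (K.piece 2 J y'') (K.σ w))) =
      ∑ y'' ∈ K.T1, S'.h1 (K.piece 0 J y'') α (K.κ ζ) + Dh * S₀.cutH α ζ *
        ∑ y'' ∈ K.T1, ∑ w ∈ K.nbr y, (S'.e 0 (K.piece 2 J y'') (K.σ w) + S'.e 1 (K.piece 2 J y'') (K.σ w)) := by
    rw [Finset.sum_add_distrib, Finset.mul_sum]
  calc S₀.h1 J α ζ ≤ _ := Dp.h1 J α ζ y hζ
    _ = S'.h1 (K.ι J) α (K.κ ζ) + (∑ y'' ∈ K.T1, S'.h1 (K.piece 0 J y'') α (K.κ ζ) + Dh * S₀.cutH α ζ *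
        ∑ y'' ∈ K.T1, ∑ w ∈ K.nbr y, (S'.e 0 (K.piece 2 J y'') (K.σ w) + S'.e 1 (K.piece 2 J y'') (K.σ w))) := by
        rw [hsplit]
    _ ≤ max (Cα α) 0 * Real.exp (-(δ / 2 * S₀.dist y y')) * S₀.cutH α ζ * S₀.supNorm J +
        (max (Cα α) 0 * (A * Nn * C₂ * B * Real.exp (δ₂ * r0)) * Λ * Real.exp (-(δ / 2 * S₀.dist y y')) *
          S₀.cutH α ζ * S₀.supNorm J +
        Dh * S₀.cutH α ζ * (2 * Nn * (C₁ * Real.exp (δ₁ * r0)) * (A * Nn * C₂ * B * Real.exp (δ₂ * r0)) * Λ *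
          Real.exp (-(δ / 2 * S₀.dist y y')) * S₀.supNorm J)) :=
        add_le_add (hmain.trans (step1.trans step2)) (add_le_add hA hB')
    _ = _ := by ring

/-- **(1.112) for G₀ from (1.112) and (1.110) for G′ and (1.114) for G₀**, one instance, with explicit constant
ε ↦ max(Cε(ε),0) + C₁·P·Λ and rate ½δ (δ also ≤ the second-order rate δ₃ of G′; Λ ≥ 0).
[cite: Balaban1984PropagatorsI, (1.133) p.39, (1.112) p.35] -/
theorem e4Entry_G0 (Fk : CarrierFacts K A B r0 Nn) (Dp : Display133 K Dh) (Sg' : ModelSigns S')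
    (Sg₀ : ModelSigns S₀) {Cε : ℝ → ℝ} {C₁ δ₁ C₂ δ₂ δ₃ δ Λ : ℝ} (hC₁ : 0 ≤ C₁) (hC₂ : 0 ≤ C₂) (hδ : 0 ≤ δ)
    (hΛ : 0 ≤ Λ) (h1 : δ ≤ δ₁) (h2 : δ ≤ δ₂) (h3 : δ ≤ δ₃) (He : ∀ n, SupEntry S' n C₁ δ₁)
    (He4 : E4Entry S' Cε δ₃) (Hl2 : ∀ p, L2Entry S₀ p C₂ δ₂) (row : URow K (δ / 2) Λ) :
    E4Entry S₀ (fun ε => max (Cε ε) 0 + C₁ * (A * Nn * C₂ * B * Real.exp (δ₂ * r0)) * Λ) (δ / 2) := by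
  intro ε J y y' hε0 hε1 hs
  have hCe0 : 0 ≤ max (Cε ε) 0 := le_max_right _ _
  have hmain := He4 ε (K.ι J) (K.σ y) (K.σ y') hε0 hε1 (Fk.supp_map J y' hs)
  have hD : Real.exp (-(δ₃ * S'.dist (K.σ y) (K.σ y'))) ≤ Real.exp (-(δ / 2 * S₀.dist y y')) :=
    decay_transfer hδ h3 (Sg₀.dist_nonneg y y') (Fk.dist_le y y')
  have hN' : 0 ≤ S'.holder ε (K.ι J) + S'.supNorm (K.ι J) :=
    add_nonneg (Sg'.holder_nonneg _ _) (Sg'.supNorm_nonneg _)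
  have step1 : Cε ε * Real.exp (-(δ₃ * S'.dist (K.σ y) (K.σ y'))) * (S'.holder ε (K.ι J) + S'.supNorm (K.ι J)) ≤
      max (Cε ε) 0 * Real.exp (-(δ₃ * S'.dist (K.σ y) (K.σ y'))) * (S'.holder ε (K.ι J) + S'.supNorm (K.ι J)) :=
    mul_le_mul_of_nonneg_right (mul_le_mul_of_nonneg_right (le_max_left _ _) (Real.exp_nonneg _)) hN'
  have step2 : max (Cε ε) 0 * Real.exp (-(δ₃ * S'.dist (K.σ y) (K.σ y'))) *
      (S'.holder ε (K.ι J) + S'.supNorm (K.ι J)) ≤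
      max (Cε ε) 0 * Real.exp (-(δ / 2 * S₀.dist y y')) * (S₀.holder ε J + S₀.supNorm J) :=
    mono3 hCe0 hD (Real.exp_nonneg _) (add_le_add (Fk.holder_map ε J) (Fk.supNorm_map J)) hN'
  have hsum := sum_sup_piece_le K Fk Sg' Sg₀ hC₁ hC₂ hδ h1 h2 1 2 (He 1) (Hl2 2) row J y y' hs
  have hc0 : 0 ≤ C₁ * (A * Nn * C₂ * B * Real.exp (δ₂ * r0)) * Λ * Real.exp (-(δ / 2 * S₀.dist y y')) := by
    have := Fk.A_nonneg; have := Fk.Nn_nonneg; have := Fk.B_nonneg; positivity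
  have hsum' : C₁ * (A * Nn * C₂ * B * Real.exp (δ₂ * r0)) * Λ * Real.exp (-(δ / 2 * S₀.dist y y')) *
      S₀.supNorm J ≤ C₁ * (A * Nn * C₂ * B * Real.exp (δ₂ * r0)) * Λ * Real.exp (-(δ / 2 * S₀.dist y y')) *
      (S₀.holder ε J + S₀.supNorm J) :=
    mul_le_mul_of_nonneg_left (le_add_of_nonneg_left (Sg₀.holder_nonneg ε J)) hc0
  calc S₀.e4 J y ≤ _ := Dp.e4 J y
    _ ≤ max (Cε ε) 0 * Real.exp (-(δ / 2 * S₀.dist y y')) * (S₀.holder ε J + S₀.supNorm J) +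
        C₁ * (A * Nn * C₂ * B * Real.exp (δ₂ * r0)) * Λ * Real.exp (-(δ / 2 * S₀.dist y y')) *
          (S₀.holder ε J + S₀.supNorm J) :=
        add_le_add (hmain.trans (step1.trans step2)) (hsum.trans hsum')
    _ = _ := by ring

/-- **(1.113) for G₀ from (1.113) and (1.111) for G′ and (1.114) for G₀**, one instance, with explicit constant
(α, ε) ↦ max(Cαε(α,ε),0) + max(Cα(α),0)·P·Λ and rate ½δ.
[cite: Balaban1984PropagatorsI, (1.133) p.39, (1.113) p.35] -/
theorem h2Entry_G0 (Fk : CarrierFacts K A B r0 Nn) (Dp : Display133 K Dh) (Sg' : ModelSigns S')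
    (Sg₀ : ModelSigns S₀) {Cα : ℝ → ℝ} {Cαε : ℝ → ℝ → ℝ} {C₂ δ₁ δ₂ δ₃ δ Λ : ℝ} (hC₂ : 0 ≤ C₂)
    (hδ : 0 ≤ δ) (hΛ : 0 ≤ Λ) (h1 : δ ≤ δ₁) (h2 : δ ≤ δ₂) (h3 : δ ≤ δ₃) (Hh1 : H1Entry S' Cα δ₁)
    (Hh2 : H2Entry S' Cαε δ₃) (Hl2 : ∀ p, L2Entry S₀ p C₂ δ₂) (row : URow K (δ / 2) Λ) :
    H2Entry S₀ (fun α ε => max (Cαε α ε) 0 + max (Cα α) 0 * (A * Nn * C₂ * B * Real.exp (δ₂ * r0)) * Λ)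
      (δ / 2) := by
  intro α ε J ζ y y' hα0 hε0 hαε hζ hs
  have hα1 : α < 1 := by linarith
  have hCa0 : 0 ≤ max (Cαε α ε) 0 := le_max_right _ _
  have hmain := Hh2 α ε (K.ι J) (K.κ ζ) (K.σ y) (K.σ y') hα0 hε0 hαε (Fk.cut_map ζ y hζ)
    (Fk.supp_map J y' hs)
  have hD : Real.exp (-(δ₃ * S'.dist (K.σ y) (K.σ y'))) ≤ Real.exp (-(δ / 2 * S₀.dist y y')) :=
    decay_transfer hδ h3 (Sg₀.dist_nonneg y y') (Fk.dist_le y y')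
  have hN' : 0 ≤ S'.holder (α + ε) (K.ι J) + S'.supNorm (K.ι J) :=
    add_nonneg (Sg'.holder_nonneg _ _) (Sg'.supNorm_nonneg _)
  have step1 : Cαε α ε * Real.exp (-(δ₃ * S'.dist (K.σ y) (K.σ y'))) * S'.cutH α (K.κ ζ) *
      (S'.holder (α + ε) (K.ι J) + S'.supNorm (K.ι J)) ≤
      max (Cαε α ε) 0 * Real.exp (-(δ₃ * S'.dist (K.σ y) (K.σ y'))) * S'.cutH α (K.κ ζ) *
      (S'.holder (α + ε) (K.ι J) + S'.supNorm (K.ι J)) :=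
    mul_le_mul_of_nonneg_right (mul_le_mul_of_nonneg_right (mul_le_mul_of_nonneg_right (le_max_left _ _)
      (Real.exp_nonneg _)) (Sg'.cutH_nonneg _ _)) hN'
  have step2 : max (Cαε α ε) 0 * Real.exp (-(δ₃ * S'.dist (K.σ y) (K.σ y'))) * S'.cutH α (K.κ ζ) *
      (S'.holder (α + ε) (K.ι J) + S'.supNorm (K.ι J)) ≤
      max (Cαε α ε) 0 * Real.exp (-(δ / 2 * S₀.dist y y')) * S₀.cutH α ζ *
      (S₀.holder (α + ε) J + S₀.supNorm J) :=
    mono4 hCa0 hD (Real.exp_nonneg _) (Fk.cutH_map α ζ) (Sg'.cutH_nonneg _ _)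
      (add_le_add (Fk.holder_map _ J) (Fk.supNorm_map J)) hN'
  have hsum := sum_h1_piece_le K Fk Sg' Sg₀ hC₂ hδ h1 h2 2 Hh1 (Hl2 2) row α J ζ y y' hα0 hα1 hζ hs
  have hc0 : 0 ≤ max (Cα α) 0 * (A * Nn * C₂ * B * Real.exp (δ₂ * r0)) * Λ *
      Real.exp (-(δ / 2 * S₀.dist y y')) * S₀.cutH α ζ := by
    have := Fk.A_nonneg; have := Fk.Nn_nonneg; have := Fk.B_nonneg; have := Sg₀.cutH_nonneg α ζ
    positivity
  have hsum' : max (Cα α) 0 * (A * Nn * C₂ * B * Real.exp (δ₂ * r0)) * Λ *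
      Real.exp (-(δ / 2 * S₀.dist y y')) * S₀.cutH α ζ * S₀.supNorm J ≤
      max (Cα α) 0 * (A * Nn * C₂ * B * Real.exp (δ₂ * r0)) * Λ *
      Real.exp (-(δ / 2 * S₀.dist y y')) * S₀.cutH α ζ * (S₀.holder (α + ε) J + S₀.supNorm J) :=
    mul_le_mul_of_nonneg_left (le_add_of_nonneg_left (Sg₀.holder_nonneg _ J)) hc0
  calc S₀.h2 J α ζ ≤ _ := Dp.h2 J α ζ y hζ
    _ ≤ max (Cαε α ε) 0 * Real.exp (-(δ / 2 * S₀.dist y y')) * S₀.cutH α ζ *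
          (S₀.holder (α + ε) J + S₀.supNorm J) +
        max (Cα α) 0 * (A * Nn * C₂ * B * Real.exp (δ₂ * r0)) * Λ *
          Real.exp (-(δ / 2 * S₀.dist y y')) * S₀.cutH α ζ * (S₀.holder (α + ε) J + S₀.supNorm J) :=
        add_le_add (hmain.trans (step1.trans step2)) (hsum.trans hsum')
    _ = _ := by ring

end Instance


/-! ## §4. Families: the hypothesis `transfer` of S3, derived -/

section Family

variable {I : Type} (famGp famG0 : I → B5.Setting) (Kf : ∀ i, Carrier133 (famGp i) (famG0 i))
  {A B r0 Nn Dh : ℝ}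

/-- **First-order transfer.** (1.110)–(1.111) uniformly for the family G₀ from (1.110)–(1.111) uniformly for the
family G′ (`FirstOrderFam famGp`) and the localized L² bounds (1.114) uniformly for G₀ (`B5.Local114Fam famG0` —
«We only have to know some weak bounds for G₀ … (1.114)»), through the located leaves `CarrierFacts`, `Display133`,
`URow` with family-uniform constants.  Rate: half the minimum of the two input rates.
[cite: Balaban1984PropagatorsI, (1.133) p.39] -/
theorem firstOrder_transfer (Fk : ∀ i, CarrierFacts (Kf i) A B r0 Nn) (Dp : ∀ i, Display133 (Kf i) Dh)
    (SgGp : ∀ i, ModelSigns (famGp i)) (SgG0 : ∀ i, ModelSigns (famG0 i))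
    (hRow : ∀ κ : ℝ, 0 < κ → ∃ Λ : ℝ, ∀ i, URow (Kf i) κ Λ)
    (h1 : FirstOrderFam famGp) (h3 : B5.Local114Fam famG0) : FirstOrderFam famG0 := by
  obtain ⟨δ₁, C₁, Cα, hδ₁, hC₁, H1⟩ := h1
  obtain ⟨δ₂, C₂, hδ₂, hC₂, H3⟩ := (local114Fam_iff famG0).mp h3
  obtain ⟨δ, hδ, hd1, hd2⟩ : ∃ δ : ℝ, 0 < δ ∧ δ ≤ δ₁ ∧ δ ≤ δ₂ :=
    ⟨min δ₁ δ₂, lt_min hδ₁ hδ₂, min_le_left _ _, min_le_right _ _⟩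
  obtain ⟨Λ₀, HΛ₀⟩ := hRow (δ / 2) (half_pos hδ)
  -- a non-negative row-sum constant
  obtain ⟨Λ, hΛ0, HΛ⟩ : ∃ Λ : ℝ, 0 ≤ Λ ∧ ∀ i, URow (Kf i) (δ / 2) Λ :=
    ⟨max Λ₀ 0, le_max_right _ _, fun i y => (HΛ₀ i y).trans (le_max_left _ _)⟩
  refine ⟨δ / 2, max (C₁ + C₁ * (A * Nn * C₂ * B * Real.exp (δ₂ * r0)) * Λ) C₁,
    fun α => max (Cα α) 0 + max (Cα α) 0 * (A * Nn * C₂ * B * Real.exp (δ₂ * r0)) * Λ +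
      Dh * (2 * Nn * (C₁ * Real.exp (δ₁ * r0)) * (A * Nn * C₂ * B * Real.exp (δ₂ * r0)) * Λ),
    half_pos hδ, lt_max_of_lt_right hC₁, fun i => ⟨fun n => ?_, ?_⟩⟩
  · intro J y y' hs
    exact B9FromB6.weaken3 (supEntry_G0 (Kf i) (Fk i) (Dp i) (SgGp i) (SgG0 i) hC₁.le hC₂.le hδ.le hd1 hd2
      (H1 i).1 (H3 i) (HΛ i) n J y y' hs) (le_max_left _ _) (hC₁.le.trans (le_max_right _ _))
      ((SgG0 i).supNorm_nonneg J) le_rfl ((SgG0 i).dist_nonneg y y')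
  · exact h1Entry_G0 (Kf i) (Fk i) (Dp i) (SgGp i) (SgG0 i) hC₁.le hC₂.le hδ.le hd1 hd2 (H1 i).1 (H1 i).2
      (H3 i) (HΛ i)

/-- **Second-order transfer.** (1.112)–(1.113) uniformly for the family G₀ from (1.110)–(1.113) uniformly for G′
(`FirstOrderFam famGp`, `SecondOrderFam famGp`) and (1.114) uniformly for G₀, through the same located leaves.
Rate: half the minimum of the three input rates. [cite: Balaban1984PropagatorsI, (1.133) p.39] -/
theorem secondOrder_transfer (Fk : ∀ i, CarrierFacts (Kf i) A B r0 Nn) (Dp : ∀ i, Display133 (Kf i) Dh)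
    (SgGp : ∀ i, ModelSigns (famGp i)) (SgG0 : ∀ i, ModelSigns (famG0 i))
    (hRow : ∀ κ : ℝ, 0 < κ → ∃ Λ : ℝ, ∀ i, URow (Kf i) κ Λ)
    (h1 : FirstOrderFam famGp) (h2 : SecondOrderFam famGp) (h3 : B5.Local114Fam famG0) :
    SecondOrderFam famG0 := by
  obtain ⟨δ₁, C₁, Cα, hδ₁, hC₁, H1⟩ := h1
  obtain ⟨δ₃, Cε, Cαε, hδ₃, H2⟩ := h2
  obtain ⟨δ₂, C₂, hδ₂, hC₂, H3⟩ := (local114Fam_iff famG0).mp h3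
  obtain ⟨δ, hδ, hd1, hd2, hd3⟩ : ∃ δ : ℝ, 0 < δ ∧ δ ≤ δ₁ ∧ δ ≤ δ₂ ∧ δ ≤ δ₃ :=
    ⟨min δ₁ (min δ₂ δ₃), lt_min hδ₁ (lt_min hδ₂ hδ₃), min_le_left _ _,
      (min_le_right _ _).trans (min_le_left _ _), (min_le_right _ _).trans (min_le_right _ _)⟩
  obtain ⟨Λ₀, HΛ₀⟩ := hRow (δ / 2) (half_pos hδ)
  obtain ⟨Λ, hΛ0, HΛ⟩ : ∃ Λ : ℝ, 0 ≤ Λ ∧ ∀ i, URow (Kf i) (δ / 2) Λ :=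
    ⟨max Λ₀ 0, le_max_right _ _, fun i y => (HΛ₀ i y).trans (le_max_left _ _)⟩
  refine ⟨δ / 2, fun ε => max (Cε ε) 0 + C₁ * (A * Nn * C₂ * B * Real.exp (δ₂ * r0)) * Λ,
    fun α ε => max (Cαε α ε) 0 + max (Cα α) 0 * (A * Nn * C₂ * B * Real.exp (δ₂ * r0)) * Λ,
    half_pos hδ, fun i => ⟨?_, ?_⟩⟩
  · exact e4Entry_G0 (Kf i) (Fk i) (Dp i) (SgGp i) (SgG0 i) hC₁.le hC₂.le hδ.le hΛ0 hd1 hd2 hd3 (H1 i).1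
      (H2 i).1 (H3 i) (HΛ i)
  · exact h2Entry_G0 (Kf i) (Fk i) (Dp i) (SgGp i) (SgG0 i) hC₂.le hδ.le hΛ0 hd1 hd2 hd3 (H1 i).2
      (H2 i).2 (H3 i) (HΛ i)

/-- **The hypothesis `transfer` of `B5FromB4.prop12G0_of_B4` (and of every later link of the S3 chain), derived**:
literally `FirstOrderFam famGp → SecondOrderFam famGp → B5.Local114Fam famG0 → FirstOrderFam famG0 ∧
SecondOrderFam famG0`, from the located leaves `CarrierFacts`, `Display133` (the identity (1.133) entrywise) and the
unit-lattice row sums.  This is the printed sentence «Properties of the operator G₀ can be easily reduced to the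
corresponding properties of the operator G′ by the equality (1.133). We only have to know some weak bounds for G₀,
for example bounds in the L²-norm (1.89), or (1.114).» made into kernel arithmetic; the operator identity itself and
the torus model stay located, not formalised. [cite: Balaban1984PropagatorsI, (1.133) p.39] -/
theorem transfer_of_display133 (Fk : ∀ i, CarrierFacts (Kf i) A B r0 Nn) (Dp : ∀ i, Display133 (Kf i) Dh)
    (SgGp : ∀ i, ModelSigns (famGp i)) (SgG0 : ∀ i, ModelSigns (famG0 i))
    (hRow : ∀ κ : ℝ, 0 < κ → ∃ Λ : ℝ, ∀ i, URow (Kf i) κ Λ) :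
    FirstOrderFam famGp → SecondOrderFam famGp → B5.Local114Fam famG0 →
      FirstOrderFam famG0 ∧ SecondOrderFam famG0 :=
  fun h1 h2 h3 => ⟨firstOrder_transfer famGp famG0 Kf Fk Dp SgGp SgG0 hRow h1 h3,
    secondOrder_transfer famGp famG0 Kf Fk Dp SgGp SgG0 hRow h1 h2 h3⟩

end Family


/-! ## §5. Corollary: S3 of Proposition 1.2 for G₀ with `transfer` discharged -/

section Corollary

open B5Ineq137 B5Ineq113 B5Ineq110Gp

/-- **`B5Ineq110Gp.prop12G0_of_B4_via135` with `transfer` discharged**: Proposition 1.2 ((1.110)–(1.114)) for the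
family G₀ = (Δ + aQ*Q)^{−1} from [2] = B4 — B4's Theorem (printed dependence) and Lemma 2.4 BY NAME, the located
displays (1.135)–(1.137), (2.35)–(2.37) and now (1.133) entrywise, the dictionaries and model-evident facts, and the
two remaining PRINTED SENTENCES of p. 39 about G₀ as the named hypotheses they are: `h11G0` («we have Proposition
1.1 for G₀») and `h114G0` («This leads also to (1.114) by the same reasoning with a random walk expansion as for
G»).  Of the four hypotheses of `B5FromB4.prop12G0_of_B4` standing for unprinted reductions (hRes, h137/h113 inside
`second`, transfer) none is left; what is left is printed mathematics (Prop. 1.1 and (1.114) for G₀, i.e. the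
momentum representation (1.134)/(1.87) and the random-walk expansion of Sect. E), not formalised here.
[cite: Balaban1984PropagatorsI, pp.39–40] -/
theorem prop12G0_of_B4_via133 {I I₄ I₂₄ : Type} (fam₄ : I₄ → B4.EtaSetting)
    (fam₂₄ : I₂₄ → B4.ScaleSetting) (famGp famG0 : I → B5.Setting) (F : ∀ i, B5FromB4.GpHolder (famGp i))
    (c : ℝ) (ι : I → ℝ → I₄)
    (Dι : ∀ (i : I) (e : ℝ), 0 < e → B5FromB4.Dict (fam₄ (ι i e)) (famGp i) (F i) c e)
    (SgGp : ∀ i, B5FromB4.ModelSigns (famGp i)) (SgG0 : ∀ i, B5FromB4.ModelSigns (famG0 i))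
    (hThm : B5FromB4.ThmDepPrinted fam₄) (h24 : B4.Lemma24Printed fam₂₄)
    (Dfam : ∀ i, ScaleData (famGp i)) (Pfam : ∀ i, GpData (Dfam i)) (L : ℝ) (d : ℕ)
    (cc cb ā aK s₀ pL : ℝ) (hL : 1 < L) (hs₀ : 0 ≤ s₀) (hpL : 0 ≤ pL) (haK : 0 ≤ aK)
    (ha : ∀ i j, |(Dfam i).a j| ≤ ā)
    (h136 : ∀ i, Display136 (Dfam i) L d) (Z : ∀ i, RowZero (Dfam i))
    (h135R : ∀ i, Display135 (dataR (Dfam i) (Pfam i)) L d 1)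
    (h135Z : ∀ i, Display135 (dataZ (Dfam i) (Pfam i)) L d 2)
    (D24 : ∀ i, Dict24 fam₂₄ (Dfam i) L s₀) (D236 : ∀ i, Dict236 fam₂₄ (Dfam i) L)
    (D24G : ∀ i, Dict24Gp fam₂₄ (Dfam i) (Pfam i) L s₀ pL)
    (Lap : ∀ i, LaplaceLeaf (Dfam i) (Pfam i) aK cb)
    (Dc : ∀ i, Dict137 (Dfam i) d) (Dc' : ∀ i, Dict113 (Dfam i) d)
    (DG : ∀ i, DictGp (Dfam i) (Pfam i) (F i) d)
    (G : ∀ i, Geometry (Dfam i) L cc) (G' : ∀ i, Geometry113 (Dfam i) L)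
    (hRow : ∀ κ : ℝ, 0 < κ → ∃ R Λ : ℝ, ∀ i, RowSums (Dfam i) L d κ R Λ)
    (N : ∀ i, NormFacts (Dfam i))
    (h11G0 : B5.Prop11Printed famG0)
    (h114G0 : B5.Prop11Printed famG0 → B5.Local114Fam famG0)
    (Kf : ∀ i, Carrier133 (famGp i) (famG0 i)) {A B r0 Nn Dh : ℝ}
    (Fk : ∀ i, CarrierFacts (Kf i) A B r0 Nn) (Dp : ∀ i, Display133 (Kf i) Dh)
    (hRowU : ∀ κ : ℝ, 0 < κ → ∃ Λ : ℝ, ∀ i, URow (Kf i) κ Λ) :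
    B5.Prop12Printed famG0 :=
  prop12G0_of_B4_via135 fam₄ fam₂₄ famGp famG0 F c ι Dι SgGp SgG0 hThm h24 Dfam Pfam L d cc cb ā aK s₀ pL hL
    hs₀ hpL haK ha h136 Z h135R h135Z D24 D236 D24G Lap Dc Dc' DG G G' hRow N h11G0 h114G0
    (transfer_of_display133 famGp famG0 Kf Fk Dp SgGp SgG0 hRowU)

end Corollary

end Literature.MathematicalPhysics.QuantumFieldTheory.Balaban1983to89.B5Transfer133
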